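import Summits.CriticalPhenomena.PercolationContinuityZ3.Theorems.SahiIsingHolleyTwoMeasures
import Literature.Probability.Percolation.PositiveAssociationLimits

/-!
# Holley for two measures on `{−1,+1}^ι`, ALL measurable increasing events and functionals

Support file of the Sahi cell (`prim-sahi`, typer seat, generation 15; `--supports stmt-CriticalPhenomena-4575`).
Theorems only (no definitions, no named facts, no sorries).  `SahiIsingHolleyTwoMeasures.lean` proved: the cross
box condition `μ₁[a,b] μ₂[a',b'] ≤ μ₁[a ∧ a', b ∧ b'] μ₂[a ∨ a', b ∨ b']` for finite measures on `{−1,+1}^ι` gives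
`μ₁(U) μ₂(Ω) ≤ μ₁(Ω) μ₂(U)` for LOCAL increasing events.  Here the locality is removed, using the product topology of
`{−1,+1}^ι` (`ι` countable: compact metrisable, Borel = product σ-algebra):

* `le_glue_restrict_plus`, `tendsto_glue_restrict_plus` — the `+`-truncations `σ ↦ (σ on J_N, + off J_N)` along an
  exhaustion dominate `σ` and converge to it; `tendsto_indicator_comp_glue_restrict_plus` — indicators of CLOSED
  UP-SETS are regular along this scheme;
* `holley_closedUpperSet_of_crossBox_spin` — the two-measure four functions theorem (`fourFunctions_of_fiber₂`)
  along the `+`-truncation scheme: `μ₁(F) μ₂(Ω) ≤ μ₁(Ω) μ₂(F)` for closed up-sets `F`;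
* **`holley_upperSet_of_crossBox_spin`** — for EVERY measurable up-set (inner regularity of `μ₁` by compact sets,
  whose upper closures are closed up-sets); **`holley_integral_of_crossBox_spin`** — `(∫ h dμ₁) μ₂(Ω) ≤ μ₁(Ω) (∫ h dμ₂)`
  for every bounded measurable increasing `h`; **`holley_of_crossBox_spin`** — probability measures:
  `∫ h dμ₁ ≤ ∫ h dμ₂` (HOLLEY'S INEQUALITY ON `{−1,+1}^ι`, DENSITY-FREE, INFINITE VOLUME).

No sorries, no new axioms.
-/

noncomputable section

namespace Summit.CriticalPhenomena.PercolationContinuityZ3.Theorems.SahiBoxTP2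

open MeasureTheory Set Filter Topology Function
open Literature.Probability.LatticeModels
open scoped ENNReal

section Nonlocal

variable {ι : Type*}

/-- The `+`-truncation dominates the configuration. [folklore] -/
theorem le_glue_restrict_plus [DecidableEq ι] (J : Finset ι) (σ : ι → ℤˣ) : σ ≤ glue J (J.restrict σ) .plus := by
  intro v
  by_cases hv : v ∈ J
  · rw [glue_apply_of_mem J _ _ hv]
    exact le_rfl
  · rw [glue_apply_of_notMem J _ _ hv]
    exact intUnits_le_one _

/-- The `+`-truncations along an exhaustion converge in the product topology. [folklore] -/
theorem tendsto_glue_restrict_plus [DecidableEq ι] {J : ℕ → Finset ι} (hJm : Monotone J)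
    (hJ : ∀ v, ∃ N, v ∈ J N) (σ : ι → ℤˣ) :
    Tendsto (fun N => glue (J N) ((J N).restrict σ) .plus) atTop (𝓝 σ) := by
  rw [tendsto_pi_nhds]
  intro v
  obtain ⟨N₀, hN₀⟩ := hJ v
  refine (tendsto_const_nhds (x := σ v)).congr' ?_
  filter_upwards [eventually_ge_atTop N₀] with N hN
  rw [glue_apply_of_mem (J N) _ _ (hJm hN hN₀)]
  rfl

/-- Indicators of closed up-sets are regular along the `+`-truncation scheme. [folklore] -/
theorem tendsto_indicator_comp_glue_restrict_plus [DecidableEq ι] {J : ℕ → Finset ι} (hJm : Monotone J)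
    (hJ : ∀ v, ∃ N, v ∈ J N) {F : Set (ι → ℤˣ)} (hFc : IsClosed F) (hF : IsUpperSet F) (σ : ι → ℤˣ) :
    Tendsto (fun N => F.indicator (1 : (ι → ℤˣ) → ℝ) (glue (J N) ((J N).restrict σ) .plus)) atTop
      (𝓝 (F.indicator 1 σ)) := by
  by_cases hσ : σ ∈ F
  · have : ∀ N, F.indicator (1 : (ι → ℤˣ) → ℝ) (glue (J N) ((J N).restrict σ) .plus) = F.indicator 1 σ :=
      fun N => by rw [indicator_of_mem hσ, indicator_of_mem (hF (le_glue_restrict_plus (J N) σ) hσ), Pi.one_apply, Pi.one_apply]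
    simp only [this]
    exact tendsto_const_nhds
  · have hev : ∀ᶠ N in atTop, glue (J N) ((J N).restrict σ) .plus ∈ Fᶜ :=
      (tendsto_glue_restrict_plus hJm hJ σ) (hFc.isOpen_compl.mem_nhds hσ)
    refine (tendsto_const_nhds (x := (0 : ℝ))).congr' (hev.mono fun N hN => ?_) |>.trans ?_
    · rw [indicator_of_notMem hN]
    · rw [indicator_of_notMem hσ]

variable [Countable ι]

/-- **Holley for two measures on `{−1,+1}^ι`, closed up-sets**: under the cross box condition,
`μ₁(F) μ₂(Ω) ≤ μ₁(Ω) μ₂(F)` for every closed up-set `F`. [this work] -/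
theorem holley_closedUpperSet_of_crossBox_spin (μ₁ μ₂ : Measure (ι → ℤˣ)) [IsFiniteMeasure μ₁]
    [IsFiniteMeasure μ₂]
    (hcross : ∀ a b a' b' : ι → ℤˣ,
      μ₁ (Icc a b) * μ₂ (Icc a' b') ≤ μ₁ (Icc (a ⊓ a') (b ⊓ b')) * μ₂ (Icc (a ⊔ a') (b ⊔ b')))
    {F : Set (ι → ℤˣ)} (hFc : IsClosed F) (hF : IsUpperSet F) : μ₁ F * μ₂ univ ≤ μ₁ univ * μ₂ F := by
  classical
  obtain ⟨J, hJm, hJ⟩ := exists_finset_exhaustion (ι := ι)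
  have hFm : MeasurableSet F := hFc.measurableSet
  have hind : ∀ x, 0 ≤ F.indicator (1 : (ι → ℤˣ) → ℝ) x ∧ F.indicator (1 : (ι → ℤˣ) → ℝ) x ≤ 1 := fun x => by
    by_cases hx : x ∈ F
    · simp [indicator_of_mem hx]
    · simp [indicator_of_notMem hx]
  have key := fourFunctions_of_fiber₂ μ₁ μ₂ (fun N σ => glue (J N) ((J N).restrict σ) .plus)
    (fun N => measurable_glue_restrict (J N)) (fun N => glue_restrict_inf (J N))
    (fun N => glue_restrict_sup (J N)) (fun N => finite_range_glue_restrict (J N))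
    (fun N => crossFiber_glue_restrict_of_crossBox μ₁ μ₂ hcross (J N))
    ![F.indicator 1, fun _ => 1, fun _ => 1, F.indicator 1]
    (fun j x => by
      fin_cases j
      · exact (hind x).1
      · exact zero_le_one
      · exact zero_le_one
      · exact (hind x).1)
    (fun j => by
      fin_cases j
      · exact measurable_one.indicator hFm
      · exact measurable_const
      · exact measurable_const
      · exact measurable_one.indicator hFm)
    (C := 1) (fun j x => by
      fin_cases j
      · exact (hind x).2
      · exact le_rfl
      · exact le_rfl
      · exact (hind x).2)
    (Eventually.of_forall fun x => tendsto_indicator_comp_glue_restrict_plus hJm hJ hFc hF x)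
    (Eventually.of_forall fun x => tendsto_const_nhds) (Eventually.of_forall fun x => tendsto_const_nhds)
    (Eventually.of_forall fun x => tendsto_indicator_comp_glue_restrict_plus hJm hJ hFc hF x)
    (fun x y => by
      show F.indicator (1 : (ι → ℤˣ) → ℝ) x * 1 ≤ 1 * F.indicator (1 : (ι → ℤˣ) → ℝ) (x ⊔ y)
      by_cases hx : x ∈ F
      · rw [indicator_of_mem hx, indicator_of_mem (hF le_sup_left hx), Pi.one_apply, Pi.one_apply]
      · rw [indicator_of_notMem hx, zero_mul]
        exact mul_nonneg zero_le_one (hind _).1)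
  change (∫ x, F.indicator (1 : (ι → ℤˣ) → ℝ) x ∂μ₁) * (∫ x, (1 : ℝ) ∂μ₂) ≤
    (∫ x, (1 : ℝ) ∂μ₁) * (∫ x, F.indicator (1 : (ι → ℤˣ) → ℝ) x ∂μ₂) at key
  simp only [integral_const, smul_eq_mul, mul_one, integral_indicator_one hFm] at key
  rw [← ofReal_measureReal (measure_ne_top μ₁ F), ← ofReal_measureReal (measure_ne_top μ₂ univ),
    ← ofReal_measureReal (measure_ne_top μ₁ univ), ← ofReal_measureReal (measure_ne_top μ₂ F),
    ← ENNReal.ofReal_mul measureReal_nonneg, ← ENNReal.ofReal_mul measureReal_nonneg]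
  exact ENNReal.ofReal_le_ofReal key

/-- **Holley for two measures on `{−1,+1}^ι`, ALL measurable increasing events**: under the cross box condition,
`μ₁(U) μ₂(Ω) ≤ μ₁(Ω) μ₂(U)` (inner regularity of `μ₁` by compact sets; upper closures of compacts are closed
up-sets). [this work] -/
theorem holley_upperSet_of_crossBox_spin (μ₁ μ₂ : Measure (ι → ℤˣ)) [IsFiniteMeasure μ₁] [IsFiniteMeasure μ₂]
    (hcross : ∀ a b a' b' : ι → ℤˣ,
      μ₁ (Icc a b) * μ₂ (Icc a' b') ≤ μ₁ (Icc (a ⊓ a') (b ⊓ b')) * μ₂ (Icc (a ⊔ a') (b ⊔ b')))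
    {U : Set (ι → ℤˣ)} (hU : IsUpperSet U) (hUm : MeasurableSet U) : μ₁ U * μ₂ univ ≤ μ₁ univ * μ₂ U := by
  -- compact inner approximations of `U` under `μ₁`
  have happ : ∀ j : ℕ, ∃ K, K ⊆ U ∧ IsCompact K ∧ μ₁ (U \ K) < ((j : ℝ≥0∞) + 1)⁻¹ := fun j =>
    hUm.exists_isCompact_sdiff_lt (measure_ne_top μ₁ _)
      (ENNReal.inv_ne_zero.2 (ENNReal.add_ne_top.2 ⟨ENNReal.natCast_ne_top j, ENNReal.one_ne_top⟩))
  choose K hKU hKc hKμ using happ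
  set E : ℕ → Set (ι → ℤˣ) := fun j => (upperClosure (accumulate K j) : Set (ι → ℤˣ)) with hEdef
  have hEc : ∀ j, IsClosed (E j) := fun j =>
    Literature.Probability.Percolation.isClosed_upperClosure_of_isCompact (isCompact_accumulate hKc j)
  have hEu : ∀ j, IsUpperSet (E j) := fun j => (upperClosure _).upper
  have hEU : ∀ j, E j ⊆ U := fun j x hx => by
    obtain ⟨a, ha, hax⟩ := mem_upperClosure.1 hx
    obtain ⟨i, -, hi⟩ := mem_accumulate.1 ha
    exact hU hax (hKU i hi)
  have hEmono : Monotone E := fun i j hij x hx => by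
    obtain ⟨a, ha, hax⟩ := mem_upperClosure.1 hx
    exact mem_upperClosure.2 ⟨a, monotone_accumulate hij ha, hax⟩
  have hKE : ∀ j, K j ⊆ E j := fun j => (subset_accumulate (s := K)).trans subset_upperClosure
  have hnull : μ₁ (U \ ⋃ j, E j) = 0 := by
    by_contra h0
    obtain ⟨N, hN⟩ := ENNReal.exists_inv_nat_lt h0
    have h1 : μ₁ (U \ ⋃ j, E j) ≤ μ₁ (U \ K N) :=
      measure_mono (sdiff_subset_sdiff_right ((hKE N).trans (subset_iUnion E N)))
    have h2 : ((N : ℝ≥0∞) + 1)⁻¹ ≤ (N : ℝ≥0∞)⁻¹ := ENNReal.inv_le_inv.2 le_self_add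
    exact lt_irrefl _ (((hN.trans_le h1).trans (hKμ N)).trans_le h2)
  have hae : (⋃ j, E j : Set (ι → ℤˣ)) =ᵐ[μ₁] U := by
    refine (ae_eq_set).2 ⟨?_, hnull⟩
    rw [sdiff_eq_empty.2 (iUnion_subset hEU), measure_empty]
  have hj : ∀ j, μ₁ (E j) * μ₂ univ ≤ μ₁ univ * μ₂ U := fun j =>
    (holley_closedUpperSet_of_crossBox_spin μ₁ μ₂ hcross (hEc j) (hEu j)).trans
      (mul_le_mul' le_rfl (measure_mono (hEU j)))
  have hlim : Tendsto (fun j => μ₁ (E j) * μ₂ univ) atTop (𝓝 (μ₁ U * μ₂ univ)) := by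
    have h1 : Tendsto (fun j => μ₁ (E j)) atTop (𝓝 (μ₁ (⋃ j, E j))) := tendsto_measure_iUnion_atTop hEmono
    rw [measure_congr hae] at h1
    exact ENNReal.Tendsto.mul_const h1 (Or.inr (measure_ne_top _ _))
  exact le_of_tendsto' hlim hj

/-- **Holley for two measures on `{−1,+1}^ι`, functions**: `(∫ h dμ₁) μ₂(Ω) ≤ μ₁(Ω) (∫ h dμ₂)` for every bounded
measurable increasing `h` of the infinite configuration. [this work] -/
theorem holley_integral_of_crossBox_spin (μ₁ μ₂ : Measure (ι → ℤˣ)) [IsFiniteMeasure μ₁] [IsFiniteMeasure μ₂]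
    (hcross : ∀ a b a' b' : ι → ℤˣ,
      μ₁ (Icc a b) * μ₂ (Icc a' b') ≤ μ₁ (Icc (a ⊓ a') (b ⊓ b')) * μ₂ (Icc (a ⊔ a') (b ⊔ b')))
    {h : (ι → ℤˣ) → ℝ} (hh : Monotone h) (hhm : Measurable h) {C : ℝ} (hhC : ∀ x, |h x| ≤ C) :
    (∫ x, h x ∂μ₁) * μ₂.real univ ≤ μ₁.real univ * ∫ x, h x ∂μ₂ :=
  integral_mul_le_mul_integral_of_upperSets μ₁ μ₂
    (fun _ hU hUm => holley_upperSet_of_crossBox_spin μ₁ μ₂ hcross hU hUm) hh hhm hhC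

/-- **HOLLEY'S INEQUALITY ON `{−1,+1}^ι`, DENSITY-FREE, INFINITE VOLUME**: probability measures `μ₁, μ₂` with the
cross box condition satisfy `∫ h dμ₁ ≤ ∫ h dμ₂` for every bounded measurable increasing functional `h`.
[this work] -/
theorem holley_of_crossBox_spin (μ₁ μ₂ : Measure (ι → ℤˣ)) [IsProbabilityMeasure μ₁] [IsProbabilityMeasure μ₂]
    (hcross : ∀ a b a' b' : ι → ℤˣ,
      μ₁ (Icc a b) * μ₂ (Icc a' b') ≤ μ₁ (Icc (a ⊓ a') (b ⊓ b')) * μ₂ (Icc (a ⊔ a') (b ⊔ b')))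
    {h : (ι → ℤˣ) → ℝ} (hh : Monotone h) (hhm : Measurable h) {C : ℝ} (hhC : ∀ x, |h x| ≤ C) :
    ∫ x, h x ∂μ₁ ≤ ∫ x, h x ∂μ₂ := by
  simpa only [probReal_univ, mul_one, one_mul] using holley_integral_of_crossBox_spin μ₁ μ₂ hcross hh hhm hhC

end Nonlocal

end Summit.CriticalPhenomena.PercolationContinuityZ3.Theorems.SahiBoxTP2
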